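import Summits.CriticalPhenomena.PercolationContinuityZ3.Theorems.Transplant.FKDoubleFanOneSidedConeSSigns
import HarnessLib

/-!
# Double fans `K₂ ∨ P_{m+1}`: the SIGN ORTHANT and the sup-norm bound of the `b`-images (certificates A: the nine coordinate signs)

Helper file (`--supports stmt-CriticalPhenomena-4575`), FK sub-lane `prim-bschramm-fk-3` (gen 41); builds on p205010 (kernel theorem, internal
audit signed; external expert review pending).  No named facts, no sorries; standard axioms.  Memo `bschramm/prim-bschramm-fk-3/FAR-CROSS-XVI.md` §5.

Mirror of `…OneSidedConeSSignsCertA/B/C` (gen 39, `a`-images) for the `b`-images `imgB q G w` of `…OneSidedDominance`: for `G, w` with the eight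
`Valid` inequalities (`0 ≤ q ≤ 1`) the hat–Plücker coordinates have the SAME fixed signs as the `a`-images (`ux, uy, uv, xv, yv, zv ≥ 0`,
`uz, xz, yz ≤ 0`, `xy` free) and `‖imgB‖_∞ ≤ ℓ(imgB) = uv+xv+yv+zv`; every sign / bound is an explicit identity `= Σ c_j·(q-factor)·(valid form
of G)·(valid form of w)`, `c_j ≥ 0` (product-form LP certificates, kit j284446, exact sympy verification).  These discharge the positivity
hypothesis `hposB` of the exact criterion `hypAS_of_crossPos2` / `hypBS_of_crossPos2` (`…TwoSidedConeSCross`) with `e₀ = e0Biv q`, `c = 1`.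
[folklore]
-/

noncomputable section

namespace Summit.CriticalPhenomena.PercolationContinuityZ3.Theorems

namespace FK

namespace ThreeApex

/-- `b_ux ≥ 0` for the `b`-image `imgB q G w`: the certificate identity (non-negative combination of valid forms). [folklore] -/
theorem imgB_ux_nonneg_eq (q : ℝ) (G w : V5) :
    (imgB q G w).ux =
      (G.z0 * G.z0) * masterN q (swapAB w)
      + (2 : ℝ) * (G.z0 * G.zab) * masterN q (swapAB w)
      + (G.z0 * G.zac) * kap (swapAB w)
      + (G.zab * G.zab) * masterN q (swapAB w)
      + (G.zab * G.zab) * (w.z0 * w.z0)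
      + (G.zab * G.zab) * (w.z0 * w.zab)
      + (G.zab * G.zab) * (w.z0 * w.zac)
      + (G.zab * G.zab) * (w.zab * w.zac)
      + (G.zab * G.zac) * (w.z0 * w.z0)
      + (G.zab * G.zac) * (w.z0 * w.zab)
      + (G.zab * G.zac) * (w.z0 * w.zac)
      + (G.zab * G.zac) * (w.z0 * w.zbc)
      + (G.zab * G.zac) * (w.z0 * w.z1)
      + q * (G.z0 * G.zab) * (w.z0 * w.z0)
      + q * (G.z0 * G.zab) * (w.z0 * w.zab)
      + q * (G.z0 * G.zab) * (w.z0 * w.zac)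
      + q * (G.z0 * G.zab) * (w.zab * w.zac)
      + (2 - q) * (G.z0 * G.zab) * kap (swapAB w)
      + (2 - q) * (G.zab * G.zab) * kap (swapAB w) := by
  simp only [imgB, wedgeH, fanComboB, conv, edgeAC, edgeBC, detach, V5.total, hx, hy, hz, masterN, kap, swapAB]; ring

/-- `b_ux ≥ 0` for every `b`-image over `Valid × Valid` (`0 ≤ q ≤ 1`). [folklore] -/
theorem imgB_ux_nonneg {q : ℝ} {G w : V5} (hq0 : 0 ≤ q) (hq1 : q ≤ 1) (hG : Valid q G) (hw : Valid q w) : 0 ≤ (imgB q G w).ux := by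
  obtain ⟨⟨hG0, hGab, hGac, hGbc, hG1⟩, hGN, hGNab, hGNbc, hGL, hGk, hGkb, hGkc⟩ := hG
  obtain ⟨⟨hw0, hwab, hwac, hwbc, hw1⟩, hwN, hwNab, hwNbc, hwL, hwk, hwkb, hwkc⟩ := hw
  have hp : 0 ≤ 1 - q := by linarith
  have hr : 0 ≤ 2 - q := by linarith
  rw [imgB_ux_nonneg_eq]
  positivity

/-- `b_uy ≥ 0` for the `b`-image `imgB q G w`: the certificate identity (non-negative combination of valid forms). [folklore] -/
theorem imgB_uy_nonneg_eq (q : ℝ) (G w : V5) :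
    (imgB q G w).uy =
      (G.z0 * G.zac) * (w.z0 * w.zbc)
      + (G.z0 * G.zac) * (w.zac * w.zbc)
      + (G.zab * G.zac) * (w.z0 * w.z0)
      + (G.zab * G.zac) * (w.z0 * w.zac)
      + (G.zab * G.zac) * (w.z0 * w.zbc)
      + (G.zab * G.zac) * (w.zac * w.zbc)
      + (G.zac * G.zac) * (w.z0 * w.z0)
      + (G.zac * G.zac) * (w.z0 * w.zac)
      + q * (G.z0 * G.zac) * (w.z0 * w.z0)
      + q * (G.z0 * G.zac) * (w.z0 * w.zac) := by
  simp only [imgB, wedgeH, fanComboB, conv, edgeAC, edgeBC, detach, V5.total, hx, hy, hz]; ring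

/-- `b_uy ≥ 0` for every `b`-image over `Valid × Valid` (`0 ≤ q ≤ 1`). [folklore] -/
theorem imgB_uy_nonneg {q : ℝ} {G w : V5} (hq0 : 0 ≤ q) (hq1 : q ≤ 1) (hG : Valid q G) (hw : Valid q w) : 0 ≤ (imgB q G w).uy := by
  obtain ⟨⟨hG0, hGab, hGac, hGbc, hG1⟩, hGN, hGNab, hGNbc, hGL, hGk, hGkb, hGkc⟩ := hG
  obtain ⟨⟨hw0, hwab, hwac, hwbc, hw1⟩, hwN, hwNab, hwNbc, hwL, hwk, hwkb, hwkc⟩ := hw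
  have hp : 0 ≤ 1 - q := by linarith
  have hr : 0 ≤ 2 - q := by linarith
  rw [imgB_uy_nonneg_eq]
  positivity

/-- `−b_uz ≥ 0` for the `b`-image `imgB q G w`: the certificate identity (non-negative combination of valid forms). [folklore] -/
theorem imgB_uz_nonpos_eq (q : ℝ) (G w : V5) :
    -(imgB q G w).uz =
      kap G * (w.z0 * w.zbc)
      + kap G * (w.zac * w.zbc)
      + lam G * (w.z0 * w.z0)
      + lam G * (w.z0 * w.zac)
      + (G.zab * G.zac) * (w.z0 * w.z0)
      + (G.zab * G.zac) * (w.z0 * w.zac) := by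
  simp only [imgB, wedgeH, fanComboB, conv, edgeAC, edgeBC, detach, V5.total, hx, hy, hz, kap, lam]; ring

/-- `−b_uz ≥ 0` for every `b`-image over `Valid × Valid` (`0 ≤ q ≤ 1`). [folklore] -/
theorem imgB_uz_nonpos {q : ℝ} {G w : V5} (_hq0 : 0 ≤ q) (hq1 : q ≤ 1) (hG : Valid q G) (hw : Valid q w) : 0 ≤ -(imgB q G w).uz := by
  obtain ⟨⟨hG0, hGab, hGac, hGbc, hG1⟩, hGN, hGNab, hGNbc, hGL, hGk, hGkb, hGkc⟩ := hG
  obtain ⟨⟨hw0, hwab, hwac, hwbc, hw1⟩, hwN, hwNab, hwNbc, hwL, hwk, hwkb, hwkc⟩ := hw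
  have hp : 0 ≤ 1 - q := by linarith
  have hr : 0 ≤ 2 - q := by linarith
  rw [imgB_uz_nonpos_eq]
  positivity

/-- `b_uv ≥ 0` for the `b`-image `imgB q G w`: the certificate identity (non-negative combination of valid forms). [folklore] -/
theorem imgB_uv_nonneg_eq (q : ℝ) (G w : V5) :
    (imgB q G w).uv =
      masterN q G * (w.z0 * w.z0)
      + masterN q G * (w.z0 * w.zab)
      + masterN q G * (w.z0 * w.zac)
      + masterN q G * (w.z0 * w.zbc)
      + masterN q G * (w.z0 * w.z1)
      + masterN q (swapBC G) * masterN q (swapAB w)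
      + masterN q (swapBC G) * (w.z0 * w.z0)
      + masterN q (swapBC G) * (w.z0 * w.zab)
      + masterN q (swapBC G) * (w.z0 * w.zac)
      + masterN q (swapBC G) * (w.zab * w.zac)
      + (G.z0 * G.z0) * masterN q (swapAB w)
      + (G.z0 * G.zac) * masterN q (swapAB w)
      + (G.z0 * G.zbc) * masterN q (swapAB w)
      + (G.zac * G.zbc) * masterN q (swapAB w)
      + (1 - q) * kap G * kap (swapAB w)
      + (1 - q) * lam G * (w.z0 * w.z0)
      + (1 - q) * lam G * (w.z0 * w.zab)
      + (1 - q) * lam G * (w.z0 * w.zac)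
      + (1 - q) * lam G * (w.zab * w.zac)
      + (1 - q) * (G.zab * G.zac) * (w.z0 * w.z0)
      + (1 - q) * (G.zab * G.zac) * (w.z0 * w.zab)
      + (1 - q) * (G.zab * G.zac) * (w.z0 * w.zac)
      + (1 - q) * (G.zab * G.zac) * (w.zab * w.zac)
      + (2 - q) * masterN q (swapBC G) * kap (swapAB w)
      + (2 - q) * kap (swapBC G) * masterN q (swapAB w)
      + ((1 - q) * (2 - q)) * kap (swapBC G) * kap (swapAB w) := by
  simp only [imgB, wedgeH, fanComboB, conv, edgeAC, edgeBC, detach, V5.total, hx, hy, hz, masterN, kap, lam, swapAB, swapBC]; ring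

/-- `b_uv ≥ 0` for every `b`-image over `Valid × Valid` (`0 ≤ q ≤ 1`). [folklore] -/
theorem imgB_uv_nonneg {q : ℝ} {G w : V5} (_hq0 : 0 ≤ q) (hq1 : q ≤ 1) (hG : Valid q G) (hw : Valid q w) : 0 ≤ (imgB q G w).uv := by
  obtain ⟨⟨hG0, hGab, hGac, hGbc, hG1⟩, hGN, hGNab, hGNbc, hGL, hGk, hGkb, hGkc⟩ := hG
  obtain ⟨⟨hw0, hwab, hwac, hwbc, hw1⟩, hwN, hwNab, hwNbc, hwL, hwk, hwkb, hwkc⟩ := hw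
  have hp : 0 ≤ 1 - q := by linarith
  have hr : 0 ≤ 2 - q := by linarith
  rw [imgB_uv_nonneg_eq]
  positivity

/-- `−b_xz ≥ 0` for the `b`-image `imgB q G w`: the certificate identity (non-negative combination of valid forms). [folklore] -/
theorem imgB_xz_nonpos_eq (q : ℝ) (G w : V5) :
    -(imgB q G w).xz =
      masterN q (swapBC G) * masterN q (swapAB w)
      + masterN q (swapBC G) * (w.z0 * w.z0)
      + masterN q (swapBC G) * (w.z0 * w.zab)
      + masterN q (swapBC G) * (w.z0 * w.zac)
      + masterN q (swapBC G) * (w.zab * w.zac)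
      + (G.z0 * G.z0) * masterN q (swapAB w)
      + (G.z0 * G.zac) * masterN q (swapAB w)
      + (G.z0 * G.zbc) * masterN q (swapAB w)
      + (G.zac * G.zbc) * masterN q (swapAB w)
      + (2 - q) * masterN q (swapBC G) * kap (swapAB w)
      + (2 - q) * kap G * kap (swapAB w)
      + (2 - q) * kap (swapBC G) * masterN q (swapAB w)
      + (2 - q) * lam G * (w.z0 * w.z0)
      + (2 - q) * lam G * (w.z0 * w.zab)
      + (2 - q) * lam G * (w.z0 * w.zac)
      + (2 - q) * lam G * (w.zab * w.zac)
      + (2 - q) * (G.zab * G.zac) * (w.z0 * w.z0)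
      + (2 - q) * (G.zab * G.zac) * (w.z0 * w.zab)
      + (2 - q) * (G.zab * G.zac) * (w.z0 * w.zac)
      + (2 - q) * (G.zab * G.zac) * (w.zab * w.zac)
      + ((1 - q) * (2 - q)) * kap (swapBC G) * kap (swapAB w) := by
  simp only [imgB, wedgeH, fanComboB, conv, edgeAC, edgeBC, detach, V5.total, hx, hy, hz, masterN, kap, lam, swapAB, swapBC]; ring

/-- `−b_xz ≥ 0` for every `b`-image over `Valid × Valid` (`0 ≤ q ≤ 1`). [folklore] -/
theorem imgB_xz_nonpos {q : ℝ} {G w : V5} (_hq0 : 0 ≤ q) (hq1 : q ≤ 1) (hG : Valid q G) (hw : Valid q w) : 0 ≤ -(imgB q G w).xz := by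
  obtain ⟨⟨hG0, hGab, hGac, hGbc, hG1⟩, hGN, hGNab, hGNbc, hGL, hGk, hGkb, hGkc⟩ := hG
  obtain ⟨⟨hw0, hwab, hwac, hwbc, hw1⟩, hwN, hwNab, hwNbc, hwL, hwk, hwkb, hwkc⟩ := hw
  have hp : 0 ≤ 1 - q := by linarith
  have hr : 0 ≤ 2 - q := by linarith
  rw [imgB_xz_nonpos_eq]
  positivity

/-- `b_xv ≥ 0` for the `b`-image `imgB q G w`: the certificate identity (non-negative combination of valid forms). [folklore] -/
theorem imgB_xv_nonneg_eq (q : ℝ) (G w : V5) :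
    (imgB q G w).xv =
      masterN q G * masterN q (swapBC w)
      + masterN q G * (w.z0 * w.z0)
      + masterN q G * (w.z0 * w.zac)
      + masterN q G * (w.z0 * w.zbc)
      + masterN q G * (w.zac * w.zbc)
      + (2 - q) * masterN q G * kap (swapBC w) := by
  simp only [imgB, wedgeH, fanComboB, conv, edgeAC, edgeBC, detach, V5.total, hx, hy, hz, masterN, kap, swapBC]; ring

/-- `b_xv ≥ 0` for every `b`-image over `Valid × Valid` (`0 ≤ q ≤ 1`). [folklore] -/
theorem imgB_xv_nonneg {q : ℝ} {G w : V5} (_hq0 : 0 ≤ q) (hq1 : q ≤ 1) (hG : Valid q G) (hw : Valid q w) : 0 ≤ (imgB q G w).xv := by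
  obtain ⟨⟨hG0, hGab, hGac, hGbc, hG1⟩, hGN, hGNab, hGNbc, hGL, hGk, hGkb, hGkc⟩ := hG
  obtain ⟨⟨hw0, hwab, hwac, hwbc, hw1⟩, hwN, hwNab, hwNbc, hwL, hwk, hwkb, hwkc⟩ := hw
  have hp : 0 ≤ 1 - q := by linarith
  have hr : 0 ≤ 2 - q := by linarith
  rw [imgB_xv_nonneg_eq]
  positivity

/-- `−b_yz ≥ 0` for the `b`-image `imgB q G w`: the certificate identity (non-negative combination of valid forms). [folklore] -/
theorem imgB_yz_nonpos_eq (q : ℝ) (G w : V5) :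
    -(imgB q G w).yz =
      masterN q G * (w.z0 * w.z0)
      + masterN q G * (w.z0 * w.zac)
      + masterN q G * (w.z0 * w.zbc)
      + masterN q G * (w.zac * w.zbc)
      + (2 - q) * kap G * (w.z0 * w.zbc)
      + (2 - q) * kap G * (w.zac * w.zbc)
      + (2 - q) * lam G * (w.z0 * w.z0)
      + (2 - q) * lam G * (w.z0 * w.zac)
      + (2 - q) * (G.zab * G.zac) * (w.z0 * w.z0)
      + (2 - q) * (G.zab * G.zac) * (w.z0 * w.zac) := by
  simp only [imgB, wedgeH, fanComboB, conv, edgeAC, edgeBC, detach, V5.total, hx, hy, hz, masterN, kap, lam]; ring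

/-- `−b_yz ≥ 0` for every `b`-image over `Valid × Valid` (`0 ≤ q ≤ 1`). [folklore] -/
theorem imgB_yz_nonpos {q : ℝ} {G w : V5} (_hq0 : 0 ≤ q) (hq1 : q ≤ 1) (hG : Valid q G) (hw : Valid q w) : 0 ≤ -(imgB q G w).yz := by
  obtain ⟨⟨hG0, hGab, hGac, hGbc, hG1⟩, hGN, hGNab, hGNbc, hGL, hGk, hGkb, hGkc⟩ := hG
  obtain ⟨⟨hw0, hwab, hwac, hwbc, hw1⟩, hwN, hwNab, hwNbc, hwL, hwk, hwkb, hwkc⟩ := hw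
  have hp : 0 ≤ 1 - q := by linarith
  have hr : 0 ≤ 2 - q := by linarith
  rw [imgB_yz_nonpos_eq]
  positivity

/-- `b_yv ≥ 0` for the `b`-image `imgB q G w`: the certificate identity (non-negative combination of valid forms). [folklore] -/
theorem imgB_yv_nonneg_eq (q : ℝ) (G w : V5) :
    (imgB q G w).yv =
      masterN q (swapBC G) * masterN q (swapAB w)
      + masterN q (swapBC G) * (w.z0 * w.z0)
      + masterN q (swapBC G) * (w.z0 * w.zab)
      + masterN q (swapBC G) * (w.z0 * w.zac)
      + masterN q (swapBC G) * (w.zab * w.zac)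
      + (G.z0 * G.z0) * masterN q (swapAB w)
      + (G.z0 * G.zac) * masterN q (swapAB w)
      + (G.z0 * G.zbc) * masterN q (swapAB w)
      + (G.zac * G.zbc) * masterN q (swapAB w)
      + (2 - q) * masterN q (swapBC G) * kap (swapAB w)
      + (2 - q) * kap (swapBC G) * masterN q (swapAB w)
      + ((1 - q) * (2 - q)) * kap (swapBC G) * kap (swapAB w) := by
  simp only [imgB, wedgeH, fanComboB, conv, edgeAC, edgeBC, detach, V5.total, hx, hy, hz, masterN, kap, swapAB, swapBC]; ring

/-- `b_yv ≥ 0` for every `b`-image over `Valid × Valid` (`0 ≤ q ≤ 1`). [folklore] -/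
theorem imgB_yv_nonneg {q : ℝ} {G w : V5} (_hq0 : 0 ≤ q) (hq1 : q ≤ 1) (hG : Valid q G) (hw : Valid q w) : 0 ≤ (imgB q G w).yv := by
  obtain ⟨⟨hG0, hGab, hGac, hGbc, hG1⟩, hGN, hGNab, hGNbc, hGL, hGk, hGkb, hGkc⟩ := hG
  obtain ⟨⟨hw0, hwab, hwac, hwbc, hw1⟩, hwN, hwNab, hwNbc, hwL, hwk, hwkb, hwkc⟩ := hw
  have hp : 0 ≤ 1 - q := by linarith
  have hr : 0 ≤ 2 - q := by linarith
  rw [imgB_yv_nonneg_eq]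
  positivity

/-- `b_zv ≥ 0` for the `b`-image `imgB q G w`: the certificate identity (non-negative combination of valid forms). [folklore] -/
theorem imgB_zv_nonneg_eq (q : ℝ) (G w : V5) :
    (imgB q G w).zv =
      masterN q G * masterN q (swapAB w)
      + masterN q G * (w.z0 * w.z0)
      + masterN q G * (w.z0 * w.zab)
      + masterN q G * (w.z0 * w.zac)
      + masterN q G * (w.zab * w.zac)
      + masterN q (swapBC G) * masterN q (swapAB w)
      + masterN q (swapBC G) * (w.z0 * w.z0)
      + masterN q (swapBC G) * (w.z0 * w.zab)
      + masterN q (swapBC G) * (w.z0 * w.zac)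
      + masterN q (swapBC G) * (w.zab * w.zac)
      + masterN q (swapAB G) * masterN q (swapAB w)
      + (G.z0 * G.z0) * masterN q (swapAB w)
      + (G.z0 * G.zab) * masterN q (swapAB w)
      + (G.zab * G.zac) * masterN q (swapAB w)
      + (G.zab * G.zbc) * masterN q (swapAB w)
      + (G.zab * G.z1) * masterN q (swapAB w)
      + (G.zab * G.z1) * (w.z0 * w.z0)
      + (G.zab * G.z1) * (w.z0 * w.zab)
      + (G.zab * G.z1) * (w.z0 * w.zac)
      + (G.zab * G.z1) * (w.zab * w.zac)
      + (G.zac * G.z1) * masterN q (swapAB w)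
      + (G.zac * G.z1) * (w.z0 * w.z0)
      + (G.zac * G.z1) * (w.z0 * w.zab)
      + (G.zac * G.z1) * (w.z0 * w.zac)
      + (G.zac * G.z1) * (w.zab * w.zac)
      + (G.zbc * G.z1) * masterN q (swapAB w)
      + (G.z1 * G.z1) * masterN q (swapAB w)
      + (G.z1 * G.z1) * (w.z0 * w.z0)
      + (G.z1 * G.z1) * (w.z0 * w.zab)
      + (G.z1 * G.z1) * (w.z0 * w.zac)
      + (G.z1 * G.z1) * (w.zab * w.zac)
      + q * (G.zab * G.zbc) * (w.z0 * w.z0)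
      + q * (G.zab * G.zbc) * (w.z0 * w.zab)
      + q * (G.zab * G.zbc) * (w.z0 * w.zac)
      + q * (G.zab * G.zbc) * (w.zab * w.zac)
      + q * (G.zac * G.zbc) * (w.z0 * w.z0)
      + q * (G.zac * G.zbc) * (w.z0 * w.zab)
      + q * (G.zac * G.zbc) * (w.z0 * w.zac)
      + q * (G.zac * G.zbc) * (w.zab * w.zac)
      + q * (G.zbc * G.z1) * (w.z0 * w.z0)
      + q * (G.zbc * G.z1) * (w.z0 * w.zab)
      + q * (G.zbc * G.z1) * (w.z0 * w.zac)
      + q * (G.zbc * G.z1) * (w.zab * w.zac)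
      + (1 - q) * kap (swapBC G) * masterN q (swapAB w)
      + (2 - q) * masterN q G * kap (swapAB w)
      + (2 - q) * masterN q (swapBC G) * kap (swapAB w)
      + (2 - q) * kap G * masterN q (swapAB w)
      + (2 - q) * kap (swapAB G) * masterN q (swapAB w)
      + (2 - q) * lam G * (w.z0 * w.z0)
      + (2 - q) * lam G * (w.z0 * w.zab)
      + (2 - q) * lam G * (w.z0 * w.zac)
      + (2 - q) * lam G * (w.zab * w.zac)
      + (2 - q) * (G.z0 * G.z1) * kap (swapAB w)
      + (2 - q) * (G.zab * G.zac) * (w.z0 * w.z0)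
      + (2 - q) * (G.zab * G.zac) * (w.z0 * w.zab)
      + (2 - q) * (G.zab * G.zac) * (w.z0 * w.zac)
      + (2 - q) * (G.zab * G.zac) * (w.zab * w.zac)
      + (2 - q) * (G.zab * G.z1) * kap (swapAB w)
      + (2 - q) * (G.zac * G.z1) * kap (swapAB w)
      + (2 - q) * (G.zbc * G.z1) * kap (swapAB w)
      + (2 - q) * (G.z1 * G.z1) * kap (swapAB w)
      + ((1 - q) * (2 - q)) * kap G * kap (swapAB w)
      + ((1 - q) * (2 - q)) * kap (swapBC G) * kap (swapAB w) := by
  simp only [imgB, wedgeH, fanComboB, conv, edgeAC, edgeBC, detach, V5.total, hx, hy, hz, masterN, kap, lam, swapAB, swapBC]; ring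

/-- `b_zv ≥ 0` for every `b`-image over `Valid × Valid` (`0 ≤ q ≤ 1`). [folklore] -/
theorem imgB_zv_nonneg {q : ℝ} {G w : V5} (hq0 : 0 ≤ q) (hq1 : q ≤ 1) (hG : Valid q G) (hw : Valid q w) : 0 ≤ (imgB q G w).zv := by
  obtain ⟨⟨hG0, hGab, hGac, hGbc, hG1⟩, hGN, hGNab, hGNbc, hGL, hGk, hGkb, hGkc⟩ := hG
  obtain ⟨⟨hw0, hwab, hwac, hwbc, hw1⟩, hwN, hwNab, hwNbc, hwL, hwk, hwkb, hwkc⟩ := hw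
  have hp : 0 ≤ 1 - q := by linarith
  have hr : 0 ≤ 2 - q := by linarith
  rw [imgB_zv_nonneg_eq]
  positivity

end ThreeApex

end FK

end Summit.CriticalPhenomena.PercolationContinuityZ3.Theorems
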